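import Literature.NumberTheory.Sieve.QuadraticRootsPrimeModuliDFISmoothing
import Literature.NumberTheory.Sieve.QuadraticRootsPrimeModuliDFIReduction
import Literature.NumberTheory.Sieve.DivisorBound
import HarnessLib

/-!
# Duke–Friedlander–Iwaniec 1995, §4: Proposition 1 from Proposition 4 (un-smoothing)

Topic `Literature/NumberTheory/Sieve`.  Second file of the deduction of DFI's Propositions 1–2
from Proposition 4 (W. Duke, J. B. Friedlander, H. Iwaniec, Ann. of Math. 141 (1995), §4
p. 432), for the named facts of `QuadraticRootsPrimeModuliDFI.lean`.  PROVED here: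

* `DFI1995.norm_sum_plateau_sub_linearForm_le` — "`L_d(M) = Δ^{−4} L*_d(M) + O((ΔM + 1) M^ε)`,
  where the error term bounds the contribution which comes from the segments
  `M < m < M + ΔM` and `2M − ΔM < m < 2M`" (p. 432): with the plateau weight of
  `QuadraticRootsPrimeModuliDFISmoothing.lean`, `|∑_m ρ_h(dm) P(m) − L_d(M)| ≤ 2(ΔM + 1) R` for
  any pointwise bound `|ρ_h(dm)| ≤ R` on `m ≤ 2M`;
* `DFI1995.norm_linearForm_le_of_smooth` — "Choosing `Δ` optimally we get
  `L_d(M) ≪ |L*_d(M)|^{1/5} M^{4/5+ε} + M^ε`" (p. 432): if every admissible smooth sum is `≤ A`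
  then `|L_d(M)| ≤ (2B + 2R) A^{1/5} M^{4/5} + 2R` (`Δ = (A/M)^{1/5}` when `A < M`, the trivial
  bound otherwise);
* `dukeFriedlanderIwaniec1995_proposition1_of_proposition4` — **Proposition 1 from
  Proposition 4** ("This yields Proposition 1 by (25)", p. 432): (25)
  (`DFI1995.smoothLinear_le_of_proposition4`) gives
  `A = K τ(hd)^{3/2} (h,d)^{1/4} d^{1/4} M^{3/4} log 2M`, and with `|ρ_h(n)| ≤ C_f τ(n)`,
  `τ(n) ≪_η n^η`, `hd ≤ C₂C₁²M³` one gets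
  `L_d(M) ≪ (h,d)^{1/20} (d/M)^{1/20} M^{1+ε}`, i.e. the named fact
  `dukeFriedlanderIwaniec1995_proposition1` [cite: DukeFriedlanderIwaniec1995, Proposition 1
  p. 425, (9); proof §4 p. 432].

No new named fact is introduced (D-0026); Proposition 4 enters as a hypothesis.

## References

* W. Duke, J. B. Friedlander, H. Iwaniec, *Equidistribution of roots of a quadratic congruence to
  prime moduli*, Ann. of Math. (2) 141 (1995), 423–441: Proposition 1 (p. 425, (9)), §4 (p. 432).
  [cite: DukeFriedlanderIwaniec1995, Proposition 1 and §4]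
* G. H. Hardy, E. M. Wright, *An Introduction to the Theory of Numbers*, Thm 315 (`τ(n) ≪ n^ε`,
  the tree's `exists_card_divisors_le_mul_rpow`). [cite: HardyWright2008, Theorem 315]
-/

noncomputable section

namespace Literature.NumberTheory.Sieve

open scoped BigOperators Polynomial Topology
open Finset Real Filter

namespace DFI1995

/-! ### Counting integers in a short real window -/

/-- The natural numbers in a real window `(x, x + ℓ]` (`x, ℓ ≥ 0`) number at most `ℓ + 1`.
[folklore] -/
theorem card_le_of_forall_mem_window {S : Finset ℕ} {x ℓ : ℝ} (hx : 0 ≤ x) (hℓ : 0 ≤ ℓ)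
    (h : ∀ n ∈ S, x < n ∧ (n : ℝ) ≤ x + ℓ) : (S.card : ℝ) ≤ ℓ + 1 := by
  have hsub : S ⊆ Finset.Ioc ⌊x⌋₊ (⌊x⌋₊ + ⌈ℓ⌉₊) := by
    intro n hn
    obtain ⟨h1, h2⟩ := h n hn
    rw [Finset.mem_Ioc]
    constructor
    · exact (Nat.floor_lt hx).2 h1
    · have h3 : (n : ℝ) < (⌊x⌋₊ : ℝ) + 1 + ⌈ℓ⌉₊ := by
        calc (n : ℝ) ≤ x + ℓ := h2
          _ < (⌊x⌋₊ + 1) + ⌈ℓ⌉₊ := add_lt_add_of_lt_of_le (Nat.lt_floor_add_one x) (Nat.le_ceil ℓ)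
      have : n < ⌊x⌋₊ + 1 + ⌈ℓ⌉₊ := by exact_mod_cast h3
      omega
  calc (S.card : ℝ) ≤ ((Finset.Ioc ⌊x⌋₊ (⌊x⌋₊ + ⌈ℓ⌉₊)).card : ℝ) := by
        exact_mod_cast Finset.card_le_card hsub
    _ = ⌈ℓ⌉₊ := by rw [Nat.card_Ioc, Nat.add_sub_cancel_left]
    _ ≤ ℓ + 1 := (Nat.ceil_lt_add_one hℓ).le

/-! ### `L_d(M)` against its smoothed version -/

/-- **The un-smoothing error** ("the error term bounds the contribution which comes from the
segments `M < m < M + ΔM` and `2M − ΔM < m < 2M`", p. 432): for `0 < Δ ≤ 1`, `M ≥ 1` and the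
plateau `P = plateau M 2M (ΔM)` (`= 1` on `[M + ΔM, 2M − ΔM]`, `= 0` off `(M, 2M)`, values in
`[0, 1]`), `|∑_{m ≤ 2M} ρ_h(dm) P(m) − L_d(M)| ≤ 2 (ΔM + 1) R` whenever `|ρ_h(dm)| ≤ R` for
`1 ≤ m ≤ 2M`. [cite: DukeFriedlanderIwaniec1995, §4 p. 432] -/
theorem norm_sum_plateau_sub_linearForm_le (f : ℤ[X]) (h : ℤ) (d : ℕ) {M Δ R : ℝ} (hM : 1 ≤ M)
    (hΔ0 : 0 < Δ) (hΔ1 : Δ ≤ 1) (hR : ∀ m ∈ Icc 1 ⌊2 * M⌋₊, ‖polyRootWeylSum f (d * m) h‖ ≤ R) :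
    ‖∑ m ∈ Icc 1 ⌊2 * M⌋₊, polyRootWeylSum f (d * m) h * (plateau M (2 * M) (Δ * M) m : ℂ) -
        linearForm f h d M‖ ≤ 2 * (Δ * M + 1) * R := by
  have hM0 : 0 < M := by linarith
  have hL : 0 < Δ * M := by positivity
  have huv : M + Δ * M ≤ 2 * M := by nlinarith
  have h1mem : 1 ∈ Icc 1 ⌊2 * M⌋₊ := by
    rw [Finset.mem_Icc]
    exact ⟨le_rfl, Nat.le_floor (by push_cast; linarith)⟩
  have hR0 : 0 ≤ R := (norm_nonneg _).trans (hR 1 h1mem)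
  set P : ℝ → ℝ := plateau M (2 * M) (Δ * M) with hP
  -- the "bad" windows
  let bad : ℕ → Prop := fun m => (M < (m : ℝ) ∧ (m : ℝ) < M + Δ * M) ∨ 2 * M - Δ * M < (m : ℝ)
  have hlin : linearForm f h d M =
      ∑ m ∈ Icc 1 ⌊2 * M⌋₊, if M < (m : ℝ) then polyRootWeylSum f (d * m) h else 0 := by
    rw [linearForm, Finset.sum_filter]
  rw [hlin, ← Finset.sum_sub_distrib]
  -- termwise bound
  have hkey : ∀ m ∈ Icc 1 ⌊2 * M⌋₊,
      ‖polyRootWeylSum f (d * m) h * (P m : ℂ) - (if M < (m : ℝ) then polyRootWeylSum f (d * m) h else 0)‖ ≤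
        if bad m then R else 0 := by
    intro m hm
    have hPle : |P m - 1| ≤ 1 := by
      rw [abs_le]
      constructor
      · linarith [plateau_nonneg hL (by linarith) (m : ℝ) (u := M) (v := 2 * M)]
      · linarith [plateau_le_one M (2 * M) (Δ * M) m]
    by_cases hMm : M < (m : ℝ)
    · rw [if_pos hMm]
      have hfac : polyRootWeylSum f (d * m) h * (P m : ℂ) - polyRootWeylSum f (d * m) h =
          polyRootWeylSum f (d * m) h * ((P m - 1 : ℝ) : ℂ) := by push_cast; ring
      rw [hfac, norm_mul, Complex.norm_real, Real.norm_eq_abs]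
      by_cases hb : bad m
      · rw [if_pos hb]
        calc ‖polyRootWeylSum f (d * m) h‖ * |P m - 1| ≤ R * 1 :=
              mul_le_mul (hR m hm) hPle (abs_nonneg _) hR0
          _ = R := mul_one R
      · rw [if_neg hb]
        have h1 : M + Δ * M ≤ m := by
          by_contra hcon
          exact hb (Or.inl ⟨hMm, not_le.1 hcon⟩)
        have h2 : (m : ℝ) ≤ 2 * M - Δ * M := by
          by_contra hcon
          exact hb (Or.inr (not_le.1 hcon))
        rw [hP, plateau_of_mem hL h1 h2, sub_self, abs_zero, mul_zero]
    · rw [if_neg hMm, sub_zero, hP, plateau_of_le hL huv (not_lt.1 hMm)]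
      simp only [Complex.ofReal_zero, mul_zero, norm_zero]
      split_ifs <;> linarith
  refine (norm_sum_le _ _).trans ((Finset.sum_le_sum hkey).trans ?_)
  rw [← Finset.sum_filter, Finset.sum_const, nsmul_eq_mul]
  -- counting the bad `m`
  have hcount : (((Icc 1 ⌊2 * M⌋₊).filter bad).card : ℝ) ≤ 2 * (Δ * M + 1) := by
    classical
    have hsplit : (Icc 1 ⌊2 * M⌋₊).filter bad ⊆
        (Icc 1 ⌊2 * M⌋₊).filter (fun m : ℕ => M < (m : ℝ) ∧ (m : ℝ) < M + Δ * M) ∪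
          (Icc 1 ⌊2 * M⌋₊).filter (fun m : ℕ => 2 * M - Δ * M < (m : ℝ)) := by
      intro m hm
      rw [Finset.mem_filter] at hm
      rw [Finset.mem_union, Finset.mem_filter, Finset.mem_filter]
      rcases hm.2 with hb | hb
      · exact Or.inl ⟨hm.1, hb⟩
      · exact Or.inr ⟨hm.1, hb⟩
    have hc1 : (((Icc 1 ⌊2 * M⌋₊).filter (fun m : ℕ => M < (m : ℝ) ∧ (m : ℝ) < M + Δ * M)).card : ℝ) ≤
        Δ * M + 1 := by
      refine card_le_of_forall_mem_window hM0.le hL.le fun n hn => ?_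
      rw [Finset.mem_filter] at hn
      exact ⟨hn.2.1, hn.2.2.le⟩
    have hc2 : (((Icc 1 ⌊2 * M⌋₊).filter (fun m : ℕ => 2 * M - Δ * M < (m : ℝ))).card : ℝ) ≤
        Δ * M + 1 := by
      refine card_le_of_forall_mem_window (x := 2 * M - Δ * M) (by linarith) hL.le fun n hn => ?_
      rw [Finset.mem_filter, Finset.mem_Icc] at hn
      refine ⟨hn.2, ?_⟩
      have := (Nat.le_floor_iff (by positivity)).1 hn.1.2
      linarith
    calc (((Icc 1 ⌊2 * M⌋₊).filter bad).card : ℝ)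
        ≤ (((Icc 1 ⌊2 * M⌋₊).filter (fun m : ℕ => M < (m : ℝ) ∧ (m : ℝ) < M + Δ * M) ∪
            (Icc 1 ⌊2 * M⌋₊).filter (fun m : ℕ => 2 * M - Δ * M < (m : ℝ))).card : ℝ) := by
          exact_mod_cast Finset.card_le_card hsplit
      _ ≤ (((Icc 1 ⌊2 * M⌋₊).filter (fun m : ℕ => M < (m : ℝ) ∧ (m : ℝ) < M + Δ * M)).card : ℝ) +
            (((Icc 1 ⌊2 * M⌋₊).filter (fun m : ℕ => 2 * M - Δ * M < (m : ℝ))).card : ℝ) := by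
          exact_mod_cast Finset.card_union_le _ _
      _ ≤ (Δ * M + 1) + (Δ * M + 1) := add_le_add hc1 hc2
      _ = 2 * (Δ * M + 1) := by ring
  calc ((((Icc 1 ⌊2 * M⌋₊).filter bad).card : ℕ) : ℝ) * R ≤ 2 * (Δ * M + 1) * R :=
      mul_le_mul_of_nonneg_right hcount hR0
    _ = 2 * (Δ * M + 1) * R := rfl

/-- The trivial bound `|L_d(M)| ≤ 2 M R`. [folklore] -/
theorem norm_linearForm_le_trivial (f : ℤ[X]) (h : ℤ) (d : ℕ) {M R : ℝ} (hM : 1 ≤ M)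
    (hR : ∀ m ∈ Icc 1 ⌊2 * M⌋₊, ‖polyRootWeylSum f (d * m) h‖ ≤ R) :
    ‖linearForm f h d M‖ ≤ 2 * M * R := by
  have h1mem : 1 ∈ Icc 1 ⌊2 * M⌋₊ := by
    rw [Finset.mem_Icc]
    exact ⟨le_rfl, Nat.le_floor (by push_cast; linarith)⟩
  have hR0 : 0 ≤ R := (norm_nonneg _).trans (hR 1 h1mem)
  rw [linearForm]
  refine (norm_sum_le _ _).trans ?_
  calc ∑ m ∈ (Icc 1 ⌊2 * M⌋₊).filter (fun m : ℕ => M < (m : ℝ)), ‖polyRootWeylSum f (d * m) h‖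
      ≤ ∑ m ∈ Icc 1 ⌊2 * M⌋₊, ‖polyRootWeylSum f (d * m) h‖ :=
        Finset.sum_le_sum_of_subset_of_nonneg (Finset.filter_subset _ _) fun _ _ _ => norm_nonneg _
    _ ≤ ∑ m ∈ Icc 1 ⌊2 * M⌋₊, R := Finset.sum_le_sum hR
    _ = ⌊2 * M⌋₊ * R := by rw [Finset.sum_const, Nat.card_Icc, nsmul_eq_mul]; norm_num
    _ ≤ 2 * M * R := mul_le_mul_of_nonneg_right (Nat.floor_le (by linarith)) hR0

/-- **Choosing `Δ` optimally** ("we get `L_d(M) ≪ |L*_d(M)|^{1/5} M^{4/5+ε} + M^ε`", p. 432):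
if every smooth sum `∑_m ρ_h(dm) g(m)` with `g ∈ C⁴` supported on `[M, 2M]`, `|g^{(j)}| ≤ M^{−j}`
(`j ≤ 4`), is bounded by `A > 0`, and `|ρ_h(dm)| ≤ R` for `m ≤ 2M`, then
`|L_d(M)| ≤ (2B + 2R) A^{1/5} M^{4/5} + 2R` (`B` the absolute constant of
`exists_smoothTransition_bound`; `Δ = (A/M)^{1/5}` and the weight `g = (Δ⁴/2B)·plateau` when
`A < M`, the trivial bound when `A ≥ M`). [cite: DukeFriedlanderIwaniec1995, §4 p. 432] -/
theorem norm_linearForm_le_of_smooth (f : ℤ[X]) (h : ℤ) (d : ℕ) {M A R B : ℝ} (hM : 1 ≤ M)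
    (hA : 0 < A) (hR : ∀ m ∈ Icc 1 ⌊2 * M⌋₊, ‖polyRootWeylSum f (d * m) h‖ ≤ R) (hB1 : 1 ≤ B)
    (hB : ∀ n : ℕ, n ≤ 4 → ∀ x : ℝ, |iteratedDeriv n Real.smoothTransition x| ≤ B)
    (h25 : ∀ g : ℝ → ℝ, ContDiff ℝ 4 g → (∀ t : ℝ, g t ≠ 0 → M ≤ t ∧ t ≤ 2 * M) →
      (∀ j : ℕ, j ≤ 4 → ∀ t : ℝ, |iteratedDeriv j g t| ≤ M ^ (-(j : ℝ))) →
      ‖∑ m ∈ Icc 1 ⌊2 * M⌋₊, polyRootWeylSum f (d * m) h * (g m : ℂ)‖ ≤ A) :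
    ‖linearForm f h d M‖ ≤ (2 * B + 2 * R) * A ^ (1 / 5 : ℝ) * M ^ (4 / 5 : ℝ) + 2 * R := by
  have hM0 : 0 < M := by linarith
  have h1mem : 1 ∈ Icc 1 ⌊2 * M⌋₊ := by
    rw [Finset.mem_Icc]
    exact ⟨le_rfl, Nat.le_floor (by push_cast; linarith)⟩
  have hR0 : 0 ≤ R := (norm_nonneg _).trans (hR 1 h1mem)
  set Q : ℝ := A ^ (1 / 5 : ℝ) * M ^ (4 / 5 : ℝ) with hQ
  have hQ0 : 0 ≤ Q := by positivity
  rcases le_or_gt M A with hMA | hAM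
  · -- trivial range
    have hMQ : M ≤ Q := by
      have : M = M ^ (1 / 5 : ℝ) * M ^ (4 / 5 : ℝ) := by
        rw [← Real.rpow_add hM0]; norm_num
      rw [this, hQ]
      exact mul_le_mul_of_nonneg_right (Real.rpow_le_rpow hM0.le hMA (by norm_num)) (by positivity)
    calc ‖linearForm f h d M‖ ≤ 2 * M * R := norm_linearForm_le_trivial f h d hM hR
      _ ≤ 2 * Q * R := by gcongr
      _ ≤ (2 * B + 2 * R) * Q + 2 * R := by nlinarith [mul_nonneg hQ0 hR0]
      _ = (2 * B + 2 * R) * A ^ (1 / 5 : ℝ) * M ^ (4 / 5 : ℝ) + 2 * R := by rw [hQ]; ring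
  · -- `Δ = (A/M)^{1/5} ∈ (0, 1)`
    set Δ : ℝ := (A / M) ^ (1 / 5 : ℝ) with hΔ
    have hΔ0 : 0 < Δ := Real.rpow_pos_of_pos (div_pos hA hM0) _
    have hΔ1 : Δ ≤ 1 := Real.rpow_le_one (by positivity) ((div_le_one hM0).2 hAM.le) (by norm_num)
    have hΔ5 : Δ ^ (5 : ℕ) = A / M := by
      rw [hΔ, ← Real.rpow_natCast, ← Real.rpow_mul (by positivity)]; norm_num
    have hΔM : Δ * M = Q := by
      rw [hΔ, hQ, Real.div_rpow hA.le hM0.le, div_mul_eq_mul_div, div_eq_iff (by positivity),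
        mul_assoc, ← Real.rpow_add hM0]
      norm_num
    have hΔ4 : A / Δ ^ 4 = Q := by
      have hΔ40 : 0 < Δ ^ 4 := by positivity
      rw [div_eq_iff hΔ40.ne']
      have : Δ ^ 4 * (Δ * M) = A := by
        rw [show Δ ^ 4 * (Δ * M) = Δ ^ 5 * M by ring, hΔ5, div_mul_cancel₀ _ hM0.ne']
      calc A = Δ ^ 4 * (Δ * M) := this.symm
        _ = Q * Δ ^ 4 := by rw [hΔM]; ring
    -- the weight
    set P : ℝ → ℝ := plateau M (2 * M) (Δ * M) with hP
    have hL : 0 < Δ * M := by positivity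
    have huv : M + Δ * M ≤ 2 * M := by nlinarith
    set cst : ℝ := Δ ^ 4 / (2 * B) with hcst
    have hcst0 : 0 < cst := by positivity
    set g : ℝ → ℝ := fun t => cst * P t with hg
    have hPs : ContDiff ℝ 4 P := contDiff_plateau _ _ _
    have hg1 : ContDiff ℝ 4 g := contDiff_const.mul hPs
    have hg2 : ∀ t : ℝ, g t ≠ 0 → M ≤ t ∧ t ≤ 2 * M := by
      intro t ht
      have hPt : P t ≠ 0 := fun h0 => ht (by simp [hg, h0])
      obtain ⟨h1, h2⟩ := plateau_ne_zero hL huv hPt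
      exact ⟨h1.le, h2.le⟩
    have hg3 : ∀ j : ℕ, j ≤ 4 → ∀ t : ℝ, |iteratedDeriv j g t| ≤ M ^ (-(j : ℝ)) := by
      intro j hj t
      have hder : iteratedDeriv j g t = cst * iteratedDeriv j P t := by
        rw [hg]
        exact iteratedDeriv_const_mul cst (hPs.of_le (by exact_mod_cast hj)).contDiffAt
      rw [hder, abs_mul, abs_of_pos hcst0]
      have hb := abs_iteratedDeriv_plateau_le hB M (2 * M) hL hj t
      calc cst * |iteratedDeriv j P t| ≤ cst * (2 * B * (Δ * M)⁻¹ ^ j) :=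
            mul_le_mul_of_nonneg_left hb hcst0.le
        _ = Δ ^ 4 * (Δ⁻¹ ^ j) * M⁻¹ ^ j := by
            rw [hcst, mul_inv, mul_pow]; field_simp
        _ ≤ Δ ^ j * (Δ⁻¹ ^ j) * M⁻¹ ^ j :=
            mul_le_mul_of_nonneg_right (mul_le_mul_of_nonneg_right
              (pow_le_pow_of_le_one hΔ0.le hΔ1 hj) (by positivity)) (by positivity)
        _ = M ^ (-(j : ℝ)) := by
            rw [← mul_pow, mul_inv_cancel₀ hΔ0.ne', one_pow, one_mul, Real.rpow_neg hM0.le,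
              Real.rpow_natCast, inv_pow]
    have hA' := h25 g hg1 hg2 hg3
    -- `∑ ρ P = (1/cst) ∑ ρ g`
    have hsumP : ∑ m ∈ Icc 1 ⌊2 * M⌋₊, polyRootWeylSum f (d * m) h * (P m : ℂ) =
        (cst⁻¹ : ℂ) * ∑ m ∈ Icc 1 ⌊2 * M⌋₊, polyRootWeylSum f (d * m) h * (g m : ℂ) := by
      rw [Finset.mul_sum]
      have hc : (cst : ℂ) ≠ 0 := by exact_mod_cast hcst0.ne'
      refine Finset.sum_congr rfl fun m _ => ?_
      simp only [hg]
      calc polyRootWeylSum f (d * m) h * (P m : ℂ)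
          = ((cst : ℂ)⁻¹ * cst) * (polyRootWeylSum f (d * m) h * (P m : ℂ)) := by
            rw [inv_mul_cancel₀ hc, one_mul]
        _ = (cst⁻¹ : ℂ) * (polyRootWeylSum f (d * m) h * ((cst * P m : ℝ) : ℂ)) := by
            push_cast; ring
    have hnormP : ‖∑ m ∈ Icc 1 ⌊2 * M⌋₊, polyRootWeylSum f (d * m) h * (P m : ℂ)‖ ≤ cst⁻¹ * A := by
      rw [hsumP, norm_mul]
      have : ‖(cst⁻¹ : ℂ)‖ = cst⁻¹ := by
        rw [show (cst⁻¹ : ℂ) = ((cst⁻¹ : ℝ) : ℂ) by push_cast; rfl, Complex.norm_real,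
          Real.norm_eq_abs, abs_of_pos (inv_pos.2 hcst0)]
      rw [this]
      exact mul_le_mul_of_nonneg_left hA' (inv_pos.2 hcst0).le
    have hcomp := norm_sum_plateau_sub_linearForm_le f h d hM hΔ0 hΔ1 hR
    have htri : ‖linearForm f h d M‖ ≤ cst⁻¹ * A + 2 * (Δ * M + 1) * R := by
      have := norm_sub_le_norm_sub_add_norm_sub (linearForm f h d M)
        (∑ m ∈ Icc 1 ⌊2 * M⌋₊, polyRootWeylSum f (d * m) h * (P m : ℂ)) 0
      -- `‖L‖ ≤ ‖L − S‖ + ‖S‖`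
      calc ‖linearForm f h d M‖
          ≤ ‖∑ m ∈ Icc 1 ⌊2 * M⌋₊, polyRootWeylSum f (d * m) h * (P m : ℂ) - linearForm f h d M‖ +
              ‖∑ m ∈ Icc 1 ⌊2 * M⌋₊, polyRootWeylSum f (d * m) h * (P m : ℂ)‖ := by
            rw [norm_sub_rev]
            exact norm_le_norm_sub_add _ _
        _ ≤ 2 * (Δ * M + 1) * R + cst⁻¹ * A := add_le_add hcomp hnormP
        _ = cst⁻¹ * A + 2 * (Δ * M + 1) * R := by ring
    have hcstA : cst⁻¹ * A = 2 * B * Q := by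
      rw [hcst, inv_div, div_mul_eq_mul_div, mul_div_assoc, hΔ4]
    rw [hcstA, hΔM] at htri
    calc ‖linearForm f h d M‖ ≤ 2 * B * Q + 2 * (Q + 1) * R := htri
      _ = (2 * B + 2 * R) * A ^ (1 / 5 : ℝ) * M ^ (4 / 5 : ℝ) + 2 * R := by rw [hQ]; ring

/-! ### Proposition 1 from Proposition 4 -/

/-- Exponent bookkeeping: `γ^{1/20} (d/M)^{1/20} M^{1+ε} = γ^{1/20} d^{1/20} M^{19/20+ε}`. [folklore] -/
theorem prop1_shape_eq {γ d M ε : ℝ} (hd : 0 < d) (hM : 0 < M) :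
    γ ^ (1 / 20 : ℝ) * (d / M) ^ (1 / 20 : ℝ) * M ^ (1 + ε) =
      γ ^ (1 / 20 : ℝ) * d ^ (1 / 20 : ℝ) * M ^ (19 / 20 + ε) := by
  rw [Real.div_rpow hd.le hM.le]
  have : M ^ (1 + ε) = M ^ (1 / 20 : ℝ) * M ^ (19 / 20 + ε) := by
    rw [← Real.rpow_add hM]; congr 1; ring
  rw [this]
  field_simp

set_option maxHeartbeats 400000 in
/-- **DFI Proposition 1 from Proposition 4** ("Choosing `Δ` optimally we get
`L_d(M) ≪ |L*_d(M)|^{1/5} M^{4/5+ε} + M^ε`.  This yields Proposition 1 by (25).", p. 432).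
With `A = K τ(hd)^{3/2} (h,d)^{1/4} d^{1/4} M^{3/4} log 2M` from (25)
(`smoothLinear_le_of_proposition4`), `|ρ_h(n)| ≤ C_f τ(n)` (`exists_norm_polyRootWeylSum_quad_le`),
the divisor bound `τ(n) ≤ C_η n^η` (`exists_card_divisors_le_mul_rpow`, `η = ε/4`) and
`hd ≤ C₂C₁²M³`, `dm ≤ 2C₁M²`, the un-smoothing inequality `norm_linearForm_le_of_smooth` gives
`|L_d(M)| ≤ K' (h,d)^{1/20} (d/M)^{1/20} M^{1+ε}` for `d ≤ C₁M`, `h ≤ C₂dM`, which is the named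
fact `dukeFriedlanderIwaniec1995_proposition1` as vendored.
[cite: DukeFriedlanderIwaniec1995, Proposition 1 p. 425 (9); proof §4 p. 432] -/
theorem _root_.Literature.NumberTheory.Sieve.dukeFriedlanderIwaniec1995_proposition1_of_proposition4
    (H4 : dukeFriedlanderIwaniec1995_proposition4) : dukeFriedlanderIwaniec1995_proposition1 := by
  intro a b c hD ε hε C₁ C₂ hC₁ hC₂
  obtain ⟨K₂₅, hK₂₅, h25⟩ := smoothLinear_le_of_proposition4 H4 hD hC₁ hC₂
  obtain ⟨Cρ, hCρ1, hρ⟩ := exists_norm_polyRootWeylSum_quad_le hD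
  set η : ℝ := ε / 4 with hη
  have hη0 : 0 < η := by positivity
  obtain ⟨Cτ, hCτ1, hτ⟩ := exists_card_divisors_le_mul_rpow hη0
  obtain ⟨B, hB1, hB⟩ := exists_smoothTransition_bound
  -- the constants
  set R₁ : ℝ := Cρ * Cτ * (2 * C₁) ^ η with hR₁
  set T₁ : ℝ := Cτ * (C₂ * C₁ ^ 2) ^ η with hT₁
  set A₁ : ℝ := K₂₅ * T₁ ^ (3 / 2 : ℝ) * ((2 : ℝ) ^ η / η) with hA₁
  have hR₁0 : 0 < R₁ := by positivity
  have hT₁0 : 0 < T₁ := by positivity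
  have hA₁0 : 0 < A₁ := by positivity
  clear_value R₁ T₁ A₁
  refine ⟨(2 * B + 2 * R₁) * A₁ ^ (1 / 5 : ℝ) + 2 * R₁, ?_⟩
  intro h hh d hd M hM hdM hhM
  have hM0 : 0 < M := by linarith
  have hd0 : (0 : ℝ) < d := by exact_mod_cast hd
  have hd1 : (1 : ℝ) ≤ d := by exact_mod_cast hd
  have hh1 : (1 : ℝ) ≤ h := by exact_mod_cast hh
  set f : ℤ[X] := quad a b c with hf
  -- `γ = (h,d)`, `τhd = τ(hd)`
  set γ : ℝ := (Nat.gcd h d : ℝ) with hγ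
  set τhd : ℝ := ((Nat.divisors (h * d)).card : ℝ) with hτhd
  have hγ1 : 1 ≤ γ := by rw [hγ]; exact_mod_cast Nat.gcd_pos_of_pos_left _ (by omega)
  have hhd0 : h * d ≠ 0 := Nat.mul_ne_zero (by omega) (by omega)
  have hτhd1 : 1 ≤ τhd := by
    rw [hτhd]; exact_mod_cast Finset.card_pos.2 ⟨1, Nat.one_mem_divisors.2 hhd0⟩
  -- the pointwise bound `R = R₁ M^{2η}` on `|ρ_h(dm)|`, `m ≤ 2M`
  set R : ℝ := R₁ * M ^ (2 * η) with hR
  have hRle : ∀ m ∈ Icc 1 ⌊2 * M⌋₊, ‖polyRootWeylSum f (d * m) h‖ ≤ R := by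
    intro m hm
    rw [Finset.mem_Icc] at hm
    have hm1 : 1 ≤ m := hm.1
    have hm2 : (m : ℝ) ≤ 2 * M := by
      have := (Nat.le_floor_iff (by positivity)).1 hm.2
      exact_mod_cast this
    have hdm0 : d * m ≠ 0 := Nat.mul_ne_zero (by omega) (by omega)
    have h1 := hρ (h : ℤ) (d * m) (Nat.one_le_iff_ne_zero.2 hdm0)
    have h2 := hτ (d * m) hdm0
    have h3 : ((d * m : ℕ) : ℝ) ≤ 2 * C₁ * M ^ 2 := by
      push_cast
      calc (d : ℝ) * m ≤ (C₁ * M) * (2 * M) := mul_le_mul hdM hm2 (by positivity) (by positivity)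
        _ = 2 * C₁ * M ^ 2 := by ring
    have h4 : ((d * m : ℕ) : ℝ) ^ η ≤ (2 * C₁) ^ η * M ^ (2 * η) := by
      calc ((d * m : ℕ) : ℝ) ^ η ≤ (2 * C₁ * M ^ 2) ^ η := Real.rpow_le_rpow (by positivity) h3 hη0.le
        _ = (2 * C₁) ^ η * M ^ (2 * η) := by
            rw [Real.mul_rpow (by positivity) (by positivity), show (M ^ 2 : ℝ) = M ^ (2 : ℝ) by norm_cast,
              ← Real.rpow_mul hM0.le]
    calc ‖polyRootWeylSum f (d * m) h‖ ≤ Cρ * ((Nat.divisors (d * m)).card : ℝ) := h1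
      _ ≤ Cρ * (Cτ * ((d * m : ℕ) : ℝ) ^ η) := mul_le_mul_of_nonneg_left h2 (by linarith)
      _ ≤ Cρ * (Cτ * ((2 * C₁) ^ η * M ^ (2 * η))) := by gcongr
      _ = R := by rw [hR, hR₁]; ring
  -- the smooth bound `A` from (25)
  set A : ℝ := K₂₅ * τhd ^ (3 / 2 : ℝ) * γ ^ (1 / 4 : ℝ) * (d : ℝ) ^ (1 / 4 : ℝ) * M ^ (3 / 4 : ℝ) *
    Real.log (2 * M) with hA
  have hlog0 : 0 < Real.log (2 * M) := Real.log_pos (by linarith)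
  have hA0 : 0 < A := by positivity
  have h25' : ∀ g : ℝ → ℝ, ContDiff ℝ 4 g → (∀ t : ℝ, g t ≠ 0 → M ≤ t ∧ t ≤ 2 * M) →
      (∀ j : ℕ, j ≤ 4 → ∀ t : ℝ, |iteratedDeriv j g t| ≤ M ^ (-(j : ℝ))) →
      ‖∑ m ∈ Icc 1 ⌊2 * M⌋₊, polyRootWeylSum f (d * m) h * (g m : ℂ)‖ ≤ A :=
    fun g hg1 hg2 hg3 => h25 h hh d hd M hM hdM hhM g hg1 hg2 hg3
  have hmain := norm_linearForm_le_of_smooth f (h : ℤ) d hM hA0 hRle hB1 hB h25'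
  -- bounding `A`
  have hhd : ((h * d : ℕ) : ℝ) ≤ C₂ * C₁ ^ 2 * M ^ 3 := by
    push_cast
    calc (h : ℝ) * d ≤ (C₂ * d * M) * (C₁ * M) := mul_le_mul hhM hdM hd0.le (by positivity)
      _ = C₂ * M * (d * (C₁ * M)) := by ring
      _ ≤ C₂ * M * ((C₁ * M) * (C₁ * M)) := by gcongr
      _ = C₂ * C₁ ^ 2 * M ^ 3 := by ring
  have hτhd_le : τhd ≤ T₁ * M ^ (3 * η) := by
    calc τhd ≤ Cτ * ((h * d : ℕ) : ℝ) ^ η := hτ (h * d) hhd0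
      _ ≤ Cτ * (C₂ * C₁ ^ 2 * M ^ 3) ^ η := by gcongr
      _ = T₁ * M ^ (3 * η) := by
          rw [hT₁, Real.mul_rpow (by positivity) (by positivity),
            show (M ^ 3 : ℝ) = M ^ (3 : ℝ) by norm_cast, ← Real.rpow_mul hM0.le]
          ring
  have hτhd32 : τhd ^ (3 / 2 : ℝ) ≤ T₁ ^ (3 / 2 : ℝ) * M ^ (9 * η / 2) := by
    calc τhd ^ (3 / 2 : ℝ) ≤ (T₁ * M ^ (3 * η)) ^ (3 / 2 : ℝ) :=
          Real.rpow_le_rpow (by positivity) hτhd_le (by norm_num)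
      _ = T₁ ^ (3 / 2 : ℝ) * M ^ (9 * η / 2) := by
          rw [Real.mul_rpow hT₁0.le (by positivity), ← Real.rpow_mul hM0.le]
          ring_nf
  have hlog_le : Real.log (2 * M) ≤ (2 : ℝ) ^ η / η * M ^ η := by
    calc Real.log (2 * M) ≤ (2 * M) ^ η / η := Real.log_le_rpow_div (by positivity) hη0
      _ = (2 : ℝ) ^ η / η * M ^ η := by rw [Real.mul_rpow (by norm_num) hM0.le]; ring
  have hA_le : A ≤ A₁ * (γ ^ (1 / 4 : ℝ) * (d : ℝ) ^ (1 / 4 : ℝ)) * M ^ (3 / 4 + 11 * η / 2) := by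
    have hMexp : M ^ (9 * η / 2) * M ^ (3 / 4 : ℝ) * M ^ η = M ^ (3 / 4 + 11 * η / 2) := by
      rw [← Real.rpow_add hM0, ← Real.rpow_add hM0]; ring_nf
    calc A = K₂₅ * τhd ^ (3 / 2 : ℝ) * (γ ^ (1 / 4 : ℝ) * (d : ℝ) ^ (1 / 4 : ℝ)) * M ^ (3 / 4 : ℝ) *
          Real.log (2 * M) := by rw [hA]; ring
      _ ≤ K₂₅ * (T₁ ^ (3 / 2 : ℝ) * M ^ (9 * η / 2)) * (γ ^ (1 / 4 : ℝ) * (d : ℝ) ^ (1 / 4 : ℝ)) *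
          M ^ (3 / 4 : ℝ) * ((2 : ℝ) ^ η / η * M ^ η) := by gcongr
      _ = A₁ * (γ ^ (1 / 4 : ℝ) * (d : ℝ) ^ (1 / 4 : ℝ)) * (M ^ (9 * η / 2) * M ^ (3 / 4 : ℝ) * M ^ η) := by
          rw [hA₁]; ring
      _ = A₁ * (γ ^ (1 / 4 : ℝ) * (d : ℝ) ^ (1 / 4 : ℝ)) * M ^ (3 / 4 + 11 * η / 2) := by rw [hMexp]
  -- `A^{1/5} M^{4/5} ≤ A₁^{1/5} γ^{1/20} d^{1/20} M^{19/20 + 11η/10}`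
  have hQ_le : A ^ (1 / 5 : ℝ) * M ^ (4 / 5 : ℝ) ≤
      A₁ ^ (1 / 5 : ℝ) * (γ ^ (1 / 20 : ℝ) * (d : ℝ) ^ (1 / 20 : ℝ)) * M ^ (19 / 20 + 11 * η / 10) := by
    have h1 : A ^ (1 / 5 : ℝ) ≤ (A₁ * (γ ^ (1 / 4 : ℝ) * (d : ℝ) ^ (1 / 4 : ℝ)) * M ^ (3 / 4 + 11 * η / 2)) ^ (1 / 5 : ℝ) :=
      Real.rpow_le_rpow hA0.le hA_le (by norm_num)
    have h2a : (γ ^ (1 / 4 : ℝ) * (d : ℝ) ^ (1 / 4 : ℝ)) ^ (1 / 5 : ℝ) =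
        γ ^ (1 / 20 : ℝ) * (d : ℝ) ^ (1 / 20 : ℝ) := by
      rw [Real.mul_rpow (by positivity) (by positivity), ← Real.rpow_mul (by positivity),
        ← Real.rpow_mul hd0.le]
      norm_num
    have h2b : (M ^ (3 / 4 + 11 * η / 2)) ^ (1 / 5 : ℝ) = M ^ ((3 / 4 + 11 * η / 2) / 5) := by
      rw [← Real.rpow_mul hM0.le]; congr 1; ring
    have h2 : (A₁ * (γ ^ (1 / 4 : ℝ) * (d : ℝ) ^ (1 / 4 : ℝ)) * M ^ (3 / 4 + 11 * η / 2)) ^ (1 / 5 : ℝ) =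
        A₁ ^ (1 / 5 : ℝ) * (γ ^ (1 / 20 : ℝ) * (d : ℝ) ^ (1 / 20 : ℝ)) * M ^ ((3 / 4 + 11 * η / 2) / 5) := by
      rw [Real.mul_rpow (by positivity) (by positivity), Real.mul_rpow (by positivity) (by positivity),
        h2a, h2b]
    have h3 : M ^ ((3 / 4 + 11 * η / 2) / 5) * M ^ (4 / 5 : ℝ) = M ^ (19 / 20 + 11 * η / 10) := by
      rw [← Real.rpow_add hM0]; ring_nf
    calc A ^ (1 / 5 : ℝ) * M ^ (4 / 5 : ℝ)
        ≤ (A₁ ^ (1 / 5 : ℝ) * (γ ^ (1 / 20 : ℝ) * (d : ℝ) ^ (1 / 20 : ℝ)) * M ^ ((3 / 4 + 11 * η / 2) / 5)) *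
            M ^ (4 / 5 : ℝ) := by rw [← h2]; exact mul_le_mul_of_nonneg_right h1 (by positivity)
      _ = A₁ ^ (1 / 5 : ℝ) * (γ ^ (1 / 20 : ℝ) * (d : ℝ) ^ (1 / 20 : ℝ)) * M ^ (19 / 20 + 11 * η / 10) := by
          rw [mul_assoc, h3]
  -- assembling
  have hM2η : 1 ≤ M ^ (2 * η) := Real.one_le_rpow hM (by positivity)
  have hBR : 2 * B + 2 * R ≤ (2 * B + 2 * R₁) * M ^ (2 * η) := by
    rw [hR]; nlinarith [hB1, hR₁0]
  have hγd1 : 1 ≤ γ ^ (1 / 20 : ℝ) * (d : ℝ) ^ (1 / 20 : ℝ) :=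
    one_le_mul_of_one_le_of_one_le (Real.one_le_rpow hγ1 (by norm_num)) (Real.one_le_rpow hd1 (by norm_num))
  set X : ℝ := γ ^ (1 / 20 : ℝ) * (d : ℝ) ^ (1 / 20 : ℝ) * M ^ (19 / 20 + ε) with hX
  have hexp1 : M ^ (2 * η) * M ^ (19 / 20 + 11 * η / 10) ≤ M ^ (19 / 20 + ε) := by
    rw [← Real.rpow_add hM0]
    refine Real.rpow_le_rpow_of_exponent_le hM ?_
    rw [hη]; linarith
  have hexp2 : M ^ (2 * η) ≤ M ^ (19 / 20 + ε) := by
    refine Real.rpow_le_rpow_of_exponent_le hM ?_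
    rw [hη]; linarith
  have hterm1 : (2 * B + 2 * R) * A ^ (1 / 5 : ℝ) * M ^ (4 / 5 : ℝ) ≤
      (2 * B + 2 * R₁) * A₁ ^ (1 / 5 : ℝ) * X := by
    calc (2 * B + 2 * R) * A ^ (1 / 5 : ℝ) * M ^ (4 / 5 : ℝ)
        = (2 * B + 2 * R) * (A ^ (1 / 5 : ℝ) * M ^ (4 / 5 : ℝ)) := by ring
      _ ≤ ((2 * B + 2 * R₁) * M ^ (2 * η)) *
            (A₁ ^ (1 / 5 : ℝ) * (γ ^ (1 / 20 : ℝ) * (d : ℝ) ^ (1 / 20 : ℝ)) * M ^ (19 / 20 + 11 * η / 10)) :=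
          mul_le_mul hBR hQ_le (by positivity) (by positivity)
      _ = (2 * B + 2 * R₁) * A₁ ^ (1 / 5 : ℝ) * (γ ^ (1 / 20 : ℝ) * (d : ℝ) ^ (1 / 20 : ℝ)) *
            (M ^ (2 * η) * M ^ (19 / 20 + 11 * η / 10)) := by ring
      _ ≤ (2 * B + 2 * R₁) * A₁ ^ (1 / 5 : ℝ) * (γ ^ (1 / 20 : ℝ) * (d : ℝ) ^ (1 / 20 : ℝ)) *
            M ^ (19 / 20 + ε) := by gcongr
      _ = (2 * B + 2 * R₁) * A₁ ^ (1 / 5 : ℝ) * X := by rw [hX]; ring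
  have hterm2 : 2 * R ≤ 2 * R₁ * X := by
    rw [hR, hX]
    calc 2 * (R₁ * M ^ (2 * η)) = 2 * R₁ * (1 * M ^ (2 * η)) := by ring
      _ ≤ 2 * R₁ * ((γ ^ (1 / 20 : ℝ) * (d : ℝ) ^ (1 / 20 : ℝ)) * M ^ (19 / 20 + ε)) := by
          gcongr
      _ = 2 * R₁ * (γ ^ (1 / 20 : ℝ) * (d : ℝ) ^ (1 / 20 : ℝ) * M ^ (19 / 20 + ε)) := by ring
  rw [show ((2 * B + 2 * R₁) * A₁ ^ (1 / 5 : ℝ) + 2 * R₁) * γ ^ (1 / 20 : ℝ) * ((d : ℝ) / M) ^ (1 / 20 : ℝ) *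
      M ^ (1 + ε) = ((2 * B + 2 * R₁) * A₁ ^ (1 / 5 : ℝ) + 2 * R₁) * (γ ^ (1 / 20 : ℝ) *
      ((d : ℝ) / M) ^ (1 / 20 : ℝ) * M ^ (1 + ε)) by ring, prop1_shape_eq hd0 hM0]
  calc ‖linearForm f h d M‖ ≤ (2 * B + 2 * R) * A ^ (1 / 5 : ℝ) * M ^ (4 / 5 : ℝ) + 2 * R := hmain
    _ ≤ (2 * B + 2 * R₁) * A₁ ^ (1 / 5 : ℝ) * X + 2 * R₁ * X := add_le_add hterm1 hterm2
    _ = ((2 * B + 2 * R₁) * A₁ ^ (1 / 5 : ℝ) + 2 * R₁) * (γ ^ (1 / 20 : ℝ) * (d : ℝ) ^ (1 / 20 : ℝ) *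
          M ^ (19 / 20 + ε)) := by rw [hX]; ring

end DFI1995

end Literature.NumberTheory.Sieve
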